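import Summits.NavierStokesRegularity.NavierStokesRegularity.Theorems.ExtremiserTransienceNearExtremalTransienceExtremiserLiouvilleConstantSpeedExample
import Summits.NavierStokesRegularity.NavierStokesRegularity.Theorems.DssFarFieldSlavingBlowupTypeIDssProfileGaussianGapIdentities
import Literature.Analysis.FluidPDE.AxisymQuotientRayAverage
import HarnessLib

/-!
# Crux `ExtremiserTransience.NearExtremalTransience` (stmt-NavierStokesRegularity-21883), line `extremiser_liouville`,
# stub K1b — THE EXPLICIT CONSTANT-SPEED FIELD: gradient bounds, TOOLS (coefficient estimates)

`--supports stmt-NavierStokesRegularity-21883` (helper).  Author: prover seat `ns-el-k1b` (g4).  Tools for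
`…ConstantSpeedExampleGradient` (`‖Dv‖ ≤ 74/Q`, bounded gradient, finite Dirichlet energy of the explicit constant-speed
field `v = fc·(x₀,x₁,0) + gc·(−x₁,x₀,0) + (1 + hc)·e₃` of `…ConstantSpeedExample`).

Contents (`u = x₀² + x₁²`, `b = x₂² + 1`, `Q = u + b = ‖x‖² + 1 ≥ 1`, `N = 2bQ³ − ub² − u²x₂² ∈ [(3/2)bQ³, 2Q⁴]`):
elementary polynomial bounds (`|xᵢ| ≤ Q/2`, `ub ≤ Q²/4`, `|x₂| ≤ b`, `√N ≤ 2Q²`, `|x₀|√u ≤ u`, `|x₂|√u ≤ Q/2`),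
norms of the geometric factors (`‖(x₀,x₁,0)‖ = ‖Jx‖ = √u`, `‖dxⱼ‖ ≤ 1`, `‖id − dx₂ ⊗ e₃‖ ≤ 2`, `‖J‖ ≤ 1`), the
coefficient bounds `|fc| ≤ 1/Q`, `|gc| ≤ 2/Q`, `‖Dfc‖·√u ≤ 9/Q`, `‖Dhc‖ ≤ 8/Q`, and the explicit derivatives
`hasFDerivAt_NN`, `hasFDerivAt_gc` (`D gc = Σⱼ (Nⱼ/(2√N Q³) − 6xⱼ√N/Q⁴) dxⱼ`).  Square roots are handled by comparing
squares; all constants are crude (the sharp bound is `‖Dv‖ ≤ 2/Q`, numerically).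

WHAT THIS IS NOT: not a counterexample to K1b; K1b is NOT proved; nothing here proves NS regularity. [folklore]
-/

noncomputable section

open Set Filter Topology MeasureTheory Metric Function
open scoped ENNReal NNReal Topology InnerProductSpace RealInnerProductSpace ContDiff
open Literature.Analysis.FluidPDE Literature.Analysis

namespace Summit.NavierStokesRegularity.NavierStokesRegularity.Theorems

-- the problem directory repeats the summit name (`NavierStokesRegularity/NavierStokesRegularity`)
set_option linter.dupNamespace false

namespace ExtremiserLiouville

namespace ConstantSpeedExample
/-! ## Elementary polynomial bounds (`u ≥ 0`, `b ≥ 1`, `Q = u + b ≥ 1`) -/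

/-- `|t| ≤ (t² + 1)/2`. [folklore] -/
private theorem abs_le_half_sq_add_one (t : ℝ) : |t| ≤ (t ^ 2 + 1) / 2 := by
  rw [abs_le]; constructor <;> nlinarith [sq_nonneg (t + 1), sq_nonneg (t - 1)]

/-- `|xᵢ| ≤ Q/2` for every coordinate. [folklore] -/
theorem abs_coord_le (x : EuclideanSpace ℝ (Fin 3)) (i : Fin 3) : |x i| ≤ QQ x / 2 := by
  have key : ∀ t : ℝ, t ^ 2 + 1 ≤ QQ x → |t| ≤ QQ x / 2 := fun t ht => by
    have := abs_le_half_sq_add_one t; linarith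
  apply key
  have h0 := sq_nonneg (x 0); have h1 := sq_nonneg (x 1); have h2 := sq_nonneg (x 2)
  fin_cases i <;> simp [QQ, uu, bb] <;> linarith

/-- `u ≤ Q`. [folklore] -/
theorem uu_le_QQ (x : EuclideanSpace ℝ (Fin 3)) : uu x ≤ QQ x := by
  have := one_le_bb x; simp only [QQ]; linarith

/-- `b ≤ Q`. [folklore] -/
theorem bb_le_QQ (x : EuclideanSpace ℝ (Fin 3)) : bb x ≤ QQ x := by
  have := uu_nonneg x; simp only [QQ]; linarith

/-- `u·b ≤ Q²/4` (AM–GM). [folklore] -/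
theorem uu_mul_bb_le (x : EuclideanSpace ℝ (Fin 3)) : uu x * bb x ≤ QQ x ^ 2 / 4 := by
  have : QQ x = uu x + bb x := rfl
  rw [this]; nlinarith [sq_nonneg (uu x - bb x)]

/-- `|x₂| ≤ b`. [folklore] -/
theorem abs_x2_le_bb (x : EuclideanSpace ℝ (Fin 3)) : |x 2| ≤ bb x := by
  have := abs_le_half_sq_add_one (x 2); simp only [bb]; nlinarith [abs_nonneg (x 2)]

/-- `N ≤ 2 Q⁴`. [folklore] -/
theorem NN_le (x : EuclideanSpace ℝ (Fin 3)) : NN x ≤ 2 * QQ x ^ 4 := by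
  have hb := bb_le_QQ x
  have hb1 := one_le_bb x
  have hu := uu_nonneg x
  have hQ := one_le_QQ x
  simp only [NN]
  nlinarith [mul_nonneg hu (sq_nonneg (bb x)), mul_nonneg (sq_nonneg (uu x)) (sq_nonneg (x 2)),
    pow_pos (QQ_pos x) 3, mul_le_mul_of_nonneg_right hb (pow_pos (QQ_pos x) 3).le]

/-- `√N ≤ 2 Q²`. [folklore] -/
theorem sqrt_NN_le (x : EuclideanSpace ℝ (Fin 3)) : Real.sqrt (NN x) ≤ 2 * QQ x ^ 2 := by
  have hQ := one_le_QQ x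
  refine Real.sqrt_le_iff.mpr ⟨by positivity, ?_⟩
  nlinarith [NN_le x, pow_pos (QQ_pos x) 4]

/-- `|x₀|·√u ≤ u`, `|x₁|·√u ≤ u`. [folklore] -/
theorem abs_coord_mul_sqrt_uu_le (x : EuclideanSpace ℝ (Fin 3)) {i : Fin 3} (hi : i = 0 ∨ i = 1) :
    |x i| * Real.sqrt (uu x) ≤ uu x := by
  have hsq : x i ^ 2 ≤ uu x := by
    rcases hi with rfl | rfl <;> simp only [uu] <;> nlinarith [sq_nonneg (x 0), sq_nonneg (x 1)]
  have h1 : |x i| ≤ Real.sqrt (uu x) := by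
    rw [← Real.sqrt_sq_eq_abs]; exact Real.sqrt_le_sqrt hsq
  calc |x i| * Real.sqrt (uu x) ≤ Real.sqrt (uu x) * Real.sqrt (uu x) :=
        mul_le_mul_of_nonneg_right h1 (Real.sqrt_nonneg _)
    _ = uu x := Real.mul_self_sqrt (uu_nonneg x)

/-- `|x₂|·√u ≤ Q/2`. [folklore] -/
theorem abs_x2_mul_sqrt_uu_le (x : EuclideanSpace ℝ (Fin 3)) : |x 2| * Real.sqrt (uu x) ≤ QQ x / 2 := by
  have hQ : QQ x = uu x + (x 2 ^ 2 + 1) := rfl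
  have hs : Real.sqrt (uu x) ^ 2 = uu x := Real.sq_sqrt (uu_nonneg x)
  nlinarith [sq_nonneg (|x 2| - Real.sqrt (uu x)), sq_abs (x 2), Real.sqrt_nonneg (uu x), abs_nonneg (x 2)]

/-- `√u ≤ Q`. [folklore] -/
theorem sqrt_uu_le (x : EuclideanSpace ℝ (Fin 3)) : Real.sqrt (uu x) ≤ QQ x := by
  have hQ := one_le_QQ x
  refine Real.sqrt_le_iff.mpr ⟨by linarith, ?_⟩
  nlinarith [uu_le_QQ x]

/-! ## Norms of the geometric factors -/

/-- `‖(x₀, x₁, 0)‖ = √u`. [folklore] -/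
theorem norm_hz (x : EuclideanSpace ℝ (Fin 3)) : ‖hz x‖ = Real.sqrt (uu x) := by
  rw [EuclideanSpace.norm_eq]
  congr 1
  simp [Fin.sum_univ_three, uu]

/-- `‖J x‖ = √u`. [folklore] -/
theorem norm_rotGen_eq (x : EuclideanSpace ℝ (Fin 3)) : ‖rotGen x‖ = Real.sqrt (uu x) := by
  rw [EuclideanSpace.norm_eq]
  congr 1
  simp [Fin.sum_univ_three, uu, rotGen, add_comm]

/-- `‖a dx₀ + b dx₁ + c dx₂‖ ≤ |a| + |b| + |c|`. [folklore] -/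
theorem norm_combo_le (a b c : ℝ) :
    ‖a • (EuclideanSpace.proj (0 : Fin 3) : EuclideanSpace ℝ (Fin 3) →L[ℝ] ℝ) +
      b • (EuclideanSpace.proj (1 : Fin 3) : EuclideanSpace ℝ (Fin 3) →L[ℝ] ℝ) +
      c • (EuclideanSpace.proj (2 : Fin 3) : EuclideanSpace ℝ (Fin 3) →L[ℝ] ℝ)‖ ≤ |a| + |b| + |c| := by
  have h0 := GaussianGap.norm_proj_le_one 0; have h1 := GaussianGap.norm_proj_le_one 1
  have h2 := GaussianGap.norm_proj_le_one 2
  calc _ ≤ ‖a • (EuclideanSpace.proj (0 : Fin 3) : EuclideanSpace ℝ (Fin 3) →L[ℝ] ℝ)‖ +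
        ‖b • (EuclideanSpace.proj (1 : Fin 3) : EuclideanSpace ℝ (Fin 3) →L[ℝ] ℝ)‖ +
        ‖c • (EuclideanSpace.proj (2 : Fin 3) : EuclideanSpace ℝ (Fin 3) →L[ℝ] ℝ)‖ := norm_add₃_le
    _ ≤ |a| + |b| + |c| := by
        rw [norm_smul, norm_smul, norm_smul, Real.norm_eq_abs, Real.norm_eq_abs, Real.norm_eq_abs]
        nlinarith [abs_nonneg a, abs_nonneg b, abs_nonneg c]

/-- `‖D hz‖ ≤ 2` (`D hz = id − dx₂ ⊗ e₃`). [folklore] -/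
theorem norm_hzL_le : ‖ContinuousLinearMap.id ℝ (EuclideanSpace ℝ (Fin 3)) -
    (EuclideanSpace.proj (2 : Fin 3) : EuclideanSpace ℝ (Fin 3) →L[ℝ] ℝ).smulRight
      (EuclideanSpace.single (2 : Fin 3) (1 : ℝ))‖ ≤ 2 := by
  calc _ ≤ ‖ContinuousLinearMap.id ℝ (EuclideanSpace ℝ (Fin 3))‖ +
        ‖(EuclideanSpace.proj (2 : Fin 3) : EuclideanSpace ℝ (Fin 3) →L[ℝ] ℝ).smulRight
          (EuclideanSpace.single (2 : Fin 3) (1 : ℝ))‖ := norm_sub_le _ _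
    _ ≤ 1 + 1 := by
        refine add_le_add ContinuousLinearMap.norm_id_le ?_
        rw [ContinuousLinearMap.norm_smulRight_apply]
        have := GaussianGap.norm_proj_le_one 2
        simp only [PiLp.norm_single, norm_one, mul_one]
        exact this
    _ = 2 := by norm_num

/-! ## Bounds on the coefficients and their derivatives -/

/-- `|fc| ≤ 1/Q`. [folklore] -/
theorem abs_fc_le (x : EuclideanSpace ℝ (Fin 3)) : |fc x| ≤ 1 / QQ x := by
  have hQ := QQ_pos x
  have hQ1 := one_le_QQ x
  rw [fc, abs_div, abs_neg, abs_mul, abs_of_nonneg (uu_nonneg x), abs_of_pos (pow_pos hQ 3),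
    div_le_div_iff₀ (pow_pos hQ 3) hQ]
  have h1 : uu x * |x 2| ≤ QQ x ^ 2 / 4 :=
    (mul_le_mul_of_nonneg_left (abs_x2_le_bb x) (uu_nonneg x)).trans (uu_mul_bb_le x)
  nlinarith [pow_pos hQ 2]

/-- `0 ≤ gc ≤ 2/Q`. [folklore] -/
theorem abs_gc_le (x : EuclideanSpace ℝ (Fin 3)) : |gc x| ≤ 2 / QQ x := by
  have hQ := QQ_pos x
  rw [gc, abs_div, abs_of_nonneg (Real.sqrt_nonneg _), abs_of_pos (pow_pos hQ 3),
    div_le_div_iff₀ (pow_pos hQ 3) hQ]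
  nlinarith [sqrt_NN_le x, pow_pos hQ 2, Real.sqrt_nonneg (NN x)]

/-- `‖D fc‖·√u ≤ 9/Q`. [folklore] -/
theorem norm_fderiv_fc_mul_sqrt_le (x : EuclideanSpace ℝ (Fin 3)) :
    ‖fderiv ℝ fc x‖ * Real.sqrt (uu x) ≤ 9 / QQ x := by
  have hQ := QQ_pos x
  have hQ1 := one_le_QQ x
  have hu := uu_nonneg x
  have hs := Real.sqrt_nonneg (uu x)
  have h0 := abs_coord_mul_sqrt_uu_le x (i := 0) (Or.inl rfl)
  have h1 := abs_coord_mul_sqrt_uu_le x (i := 1) (Or.inr rfl)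
  have hx2 := abs_x2_le_bb x
  have hub := uu_mul_bb_le x
  have hsu := sqrt_uu_le x
  have h3 : |3 * uu x - QQ x| ≤ 3 * QQ x := by
    rw [abs_le]; constructor <;> nlinarith [uu_le_QQ x]
  have h6 : |6 * x 2 ^ 2 - QQ x| ≤ 6 * QQ x := by
    have : x 2 ^ 2 ≤ QQ x := by have := bb_le_QQ x; simp only [bb] at this; nlinarith
    rw [abs_le]; constructor <;> nlinarith
  rw [(hasFDerivAt_fc x).fderiv]
  refine (mul_le_mul_of_nonneg_right (norm_combo_le _ _ _) hs).trans ?_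
  -- the three terms
  have tA : |2 * x 0 * x 2 * (3 * uu x - QQ x) / QQ x ^ 4| * Real.sqrt (uu x) ≤ 3 / 2 / QQ x := by
    rw [abs_div, abs_of_pos (pow_pos hQ 4), div_mul_eq_mul_div, div_le_div_iff₀ (pow_pos hQ 4) hQ]
    have e : |2 * x 0 * x 2 * (3 * uu x - QQ x)| * Real.sqrt (uu x) =
        2 * (|x 0| * Real.sqrt (uu x)) * |x 2| * |3 * uu x - QQ x| := by
      rw [abs_mul, abs_mul, abs_mul, abs_two]; ring
    rw [e]
    have hb0 : 0 ≤ 2 * uu x * bb x := by have := (bb_pos x).le; positivity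
    have : 2 * (|x 0| * Real.sqrt (uu x)) * |x 2| * |3 * uu x - QQ x| ≤ 2 * uu x * bb x * (3 * QQ x) := by
      gcongr
    nlinarith [pow_pos hQ 2]
  have tB : |2 * x 1 * x 2 * (3 * uu x - QQ x) / QQ x ^ 4| * Real.sqrt (uu x) ≤ 3 / 2 / QQ x := by
    rw [abs_div, abs_of_pos (pow_pos hQ 4), div_mul_eq_mul_div, div_le_div_iff₀ (pow_pos hQ 4) hQ]
    have e : |2 * x 1 * x 2 * (3 * uu x - QQ x)| * Real.sqrt (uu x) =
        2 * (|x 1| * Real.sqrt (uu x)) * |x 2| * |3 * uu x - QQ x| := by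
      rw [abs_mul, abs_mul, abs_mul, abs_two]; ring
    rw [e]
    have hb0 : 0 ≤ 2 * uu x * bb x := by have := (bb_pos x).le; positivity
    have : 2 * (|x 1| * Real.sqrt (uu x)) * |x 2| * |3 * uu x - QQ x| ≤ 2 * uu x * bb x * (3 * QQ x) := by
      gcongr
    nlinarith [pow_pos hQ 2]
  have tC : |uu x * (6 * x 2 ^ 2 - QQ x) / QQ x ^ 4| * Real.sqrt (uu x) ≤ 6 / QQ x := by
    rw [abs_div, abs_of_pos (pow_pos hQ 4), div_mul_eq_mul_div, div_le_div_iff₀ (pow_pos hQ 4) hQ]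
    rw [abs_mul, abs_of_nonneg hu]
    have : uu x * |6 * x 2 ^ 2 - QQ x| * Real.sqrt (uu x) ≤ uu x * (6 * QQ x) * QQ x := by gcongr
    nlinarith [uu_le_QQ x, pow_pos hQ 2, pow_pos hQ 3]
  have e9 : (9 : ℝ) / QQ x = 3 / 2 / QQ x + 3 / 2 / QQ x + 6 / QQ x := by ring
  rw [add_mul, add_mul, e9]
  exact add_le_add (add_le_add tA tB) tC

/-- `‖D hc‖ ≤ 8/Q`. [folklore] -/
theorem norm_fderiv_hc_le (x : EuclideanSpace ℝ (Fin 3)) : ‖fderiv ℝ hc x‖ ≤ 8 / QQ x := by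
  have hQ := QQ_pos x
  have hQ1 := one_le_QQ x
  have hu := uu_nonneg x
  have hb := (bb_pos x).le
  have hub := uu_mul_bb_le x
  have h3 : |3 * uu x - QQ x| ≤ 3 * QQ x := by
    rw [abs_le]; constructor <;> nlinarith [uu_le_QQ x]
  have h3b : |3 * bb x - QQ x| ≤ 3 * QQ x := by
    rw [abs_le]; constructor <;> nlinarith [bb_le_QQ x]
  rw [(hasFDerivAt_hc x).fderiv]
  refine (norm_combo_le _ _ _).trans ?_
  have tA : ∀ i : Fin 3, |2 * x i * bb x * (3 * uu x - QQ x) / QQ x ^ 4| ≤ 3 / QQ x := fun i => by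
    rw [abs_div, abs_of_pos (pow_pos hQ 4), div_le_div_iff₀ (pow_pos hQ 4) hQ, abs_mul, abs_mul, abs_mul,
      abs_two, abs_of_nonneg hb]
    have hxi := abs_coord_le x i
    have : 2 * |x i| * bb x * |3 * uu x - QQ x| ≤ 2 * (QQ x / 2) * QQ x * (3 * QQ x) := by
      gcongr; exact bb_le_QQ x
    nlinarith [pow_pos hQ 3]
  have tC : |2 * x 2 * uu x * (3 * bb x - QQ x) / QQ x ^ 4| ≤ 2 / QQ x := by
    rw [abs_div, abs_of_pos (pow_pos hQ 4), div_le_div_iff₀ (pow_pos hQ 4) hQ, abs_mul, abs_mul, abs_mul,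
      abs_two, abs_of_nonneg hu]
    have hxu : |x 2| * uu x ≤ QQ x ^ 2 / 4 := by
      calc |x 2| * uu x ≤ bb x * uu x := mul_le_mul_of_nonneg_right (abs_x2_le_bb x) hu
        _ ≤ QQ x ^ 2 / 4 := by rw [mul_comm]; exact hub
    have : 2 * |x 2| * uu x * |3 * bb x - QQ x| ≤ 2 * (QQ x ^ 2 / 4) * (3 * QQ x) := by
      have h0 : 0 ≤ |3 * bb x - QQ x| := abs_nonneg _
      nlinarith [mul_le_mul_of_nonneg_right hxu h0, mul_nonneg (mul_nonneg (abs_nonneg (x 2)) hu) h0,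
        abs_nonneg (x 2)]
    nlinarith [pow_pos hQ 3]
  have e8 : (8 : ℝ) / QQ x = 3 / QQ x + 3 / QQ x + 2 / QQ x := by ring
  rw [e8]
  exact add_le_add (add_le_add (tA 0) (tA 1)) tC


/-! ## The swirl coefficient: `D N`, `D gc` and `‖D gc‖·√u ≤ 53/Q` -/

/-- `D N = N₀ dx₀ + N₁ dx₁ + N₂ dx₂` with `N₀ = x₀(12bQ² − 2b² − 4u x₂²)`, `N₁ = x₁(…)`,
`N₂ = x₂(4Q³ + 12bQ² − 4ub − 2u²)`. [folklore] -/
theorem hasFDerivAt_NN (x : EuclideanSpace ℝ (Fin 3)) :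
    HasFDerivAt NN ((x 0 * (12 * bb x * QQ x ^ 2 - 2 * bb x ^ 2 - 4 * uu x * x 2 ^ 2)) •
        (EuclideanSpace.proj (0 : Fin 3) : EuclideanSpace ℝ (Fin 3) →L[ℝ] ℝ) +
      (x 1 * (12 * bb x * QQ x ^ 2 - 2 * bb x ^ 2 - 4 * uu x * x 2 ^ 2)) •
        (EuclideanSpace.proj (1 : Fin 3) : EuclideanSpace ℝ (Fin 3) →L[ℝ] ℝ) +
      (x 2 * (4 * QQ x ^ 3 + 12 * bb x * QQ x ^ 2 - 4 * uu x * bb x - 2 * uu x ^ 2)) •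
        (EuclideanSpace.proj (2 : Fin 3) : EuclideanSpace ℝ (Fin 3) →L[ℝ] ℝ)) x := by
  show HasFDerivAt (fun y => 2 * bb y * QQ y ^ 3 - uu y * bb y ^ 2 - uu y ^ 2 * y 2 ^ 2) _ x
  refine (((((hasFDerivAt_bb x).const_mul 2).fun_mul ((hasFDerivAt_QQ x).pow 3)).fun_sub
    ((hasFDerivAt_uu x).fun_mul ((hasFDerivAt_bb x).pow 2))).fun_sub
    (((hasFDerivAt_uu x).pow 2).fun_mul
      (((EuclideanSpace.proj (2 : Fin 3) : EuclideanSpace ℝ (Fin 3) →L[ℝ] ℝ).hasFDerivAt).pow 2))).congr_fderiv ?_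
  refine ContinuousLinearMap.ext fun v => ?_
  have hQ : QQ x = uu x + bb x := rfl
  simp [hQ, uu, bb]
  ring

/-- `D gc = Σⱼ Gⱼ dxⱼ`, `Gⱼ = Nⱼ/(2√N Q³) − 6 xⱼ √N / Q⁴`. [folklore] -/
theorem hasFDerivAt_gc (x : EuclideanSpace ℝ (Fin 3)) :
    HasFDerivAt gc
      ((x 0 * (12 * bb x * QQ x ^ 2 - 2 * bb x ^ 2 - 4 * uu x * x 2 ^ 2) / (2 * Real.sqrt (NN x) * QQ x ^ 3) -
          6 * x 0 * Real.sqrt (NN x) / QQ x ^ 4) •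
        (EuclideanSpace.proj (0 : Fin 3) : EuclideanSpace ℝ (Fin 3) →L[ℝ] ℝ) +
      (x 1 * (12 * bb x * QQ x ^ 2 - 2 * bb x ^ 2 - 4 * uu x * x 2 ^ 2) / (2 * Real.sqrt (NN x) * QQ x ^ 3) -
          6 * x 1 * Real.sqrt (NN x) / QQ x ^ 4) •
        (EuclideanSpace.proj (1 : Fin 3) : EuclideanSpace ℝ (Fin 3) →L[ℝ] ℝ) +
      (x 2 * (4 * QQ x ^ 3 + 12 * bb x * QQ x ^ 2 - 4 * uu x * bb x - 2 * uu x ^ 2) / (2 * Real.sqrt (NN x) * QQ x ^ 3) -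
          6 * x 2 * Real.sqrt (NN x) / QQ x ^ 4) •
        (EuclideanSpace.proj (2 : Fin 3) : EuclideanSpace ℝ (Fin 3) →L[ℝ] ℝ)) x := by
  have hQ := QQ_ne_zero x
  have hN : Real.sqrt (NN x) ≠ 0 := (Real.sqrt_pos.mpr (NN_pos x)).ne'
  have e : gc = fun y => Real.sqrt (NN y) * ((QQ y)⁻¹) ^ 3 := by
    funext y; rw [gc, inv_pow, div_eq_mul_inv]
  rw [e]
  refine (((hasFDerivAt_NN x).sqrt (NN_pos x).ne').fun_mul ((hasFDerivAt_inv_QQ x).pow 3)).congr_fderiv ?_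
  refine ContinuousLinearMap.ext fun v => ?_
  simp
  field_simp
  ring

end ConstantSpeedExample

end ExtremiserLiouville

end Summit.NavierStokesRegularity.NavierStokesRegularity.Theorems

end
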